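import Mathlib
import Literature.Analysis.FluidPDE.WeaklyHarmonicInteriorBound
import Literature.Analysis.FluidPDE.DivCurlAnnihilator
import Literature.Analysis.FluidPDE.WeakGradientIBP
import Literature.Analysis.FunctionSpaces.SobolevTraceDensityProofs
import HarnessLib

/-!
# Fields on `ℝ³` with symmetric, trace-free weak gradient and sub-volume growth vanish — tools for the
# IRROTATIONAL stratum of the crux `EulerZoomLiouville.PowerGaugeEulerLiouville`

Route `EulerZoomLiouville` (NavierStokesRegularity), crux E = stmt-NavierStokesRegularity-19832
`PowerGaugeEulerLiouville` (an ancient local-energy Euler flow in Seregin's power-gauged class vanishes;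
OPEN on the window `0 < ρ ≤ 1/2`).  The lead's line meters progress on the open core stub through STRATA;
this file is the spatial half of the potential-flow stratum (companion file
`EulerZoomLiouvillePowerGaugeEulerLiouvilleIrrotational.lean` does the space–time assembly):

* `ae_eq_zero_of_weaklyHarmonic_of_growth` — **Liouville for weakly harmonic `h ∈ L¹_loc(ℝ³)` of
  sub-volume quadratic growth** `∫_{B(0,r)} |h|² ≤ K r^m` (`r > r₀`), `m < 3`: `h = 0` a.e.  Proof: the
  interior `L^∞–L¹` estimate for weakly harmonic functions (tree
  `exists_const_ae_abs_le_integral_of_weaklyHarmonic` [GilbargTrudinger2001 Thm 2.1]) and Cauchy–Schwarz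
  give `|h(x)| ≤ C r^{(m−3)/2} → 0` for a.e. `x`;
* `integral_inner_curlPair_eq_zero_of_symm` — a field whose weak gradient is a.e. a SYMMETRIC linear map
  (`curl = 0`) annihilates the curl-type test fields `(∂ₐ g) c − (∂_c g) a`;
* `isWeaklyDivFree_of_trace_eq_zero` — a field whose weak gradient is a.e. TRACE-FREE is weakly
  divergence free;
* `ae_eq_zero_of_symm_traceFree_of_growth` — hence (components weakly harmonic by the tree's
  `integral_laplacian_mul_inner_eq_zero_of_curlPair` [LemarieRieusset2016 Thm 4.4]) such a field with
  sub-volume quadratic growth vanishes a.e.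

WHAT THIS IS NOT: not NS, not the crux — elementary harmonic-function tools. [folklore]
-/

noncomputable section

set_option linter.dupNamespace false

open MeasureTheory Set Filter Topology Metric Function TopologicalSpace
open scoped ENNReal NNReal InnerProductSpace RealInnerProductSpace Laplacian

namespace Summit.NavierStokesRegularity.NavierStokesRegularity.Theorems.PowerGaugeEulerLiouville

open Literature.Analysis Literature.Analysis.FunctionSpaces Literature.Analysis.FluidPDE

/-! ## Weakly harmonic functions of sub-volume quadratic growth vanish -/

/-- **Liouville for weakly harmonic functions of sub-volume quadratic growth.**  Let
`h ∈ L¹_loc(ℝ³)` be weakly harmonic (`∫ h Δφ = 0` for all `φ ∈ C_c^∞`) with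
`∫_{B(0,r)} |h|² ≤ K r^m` for all `r > r₀`, where `m < 3`.  Then `h = 0` a.e.: the interior
`L^∞–L¹` estimate for weakly harmonic functions (`|h(x)| ≤ C r⁻³ ∫_{B(0,r)} |h|` a.e. on
`B(0, r/2)`, tree `exists_const_ae_abs_le_integral_of_weaklyHarmonic`) and Cauchy–Schwarz give
`|h(x)| ≤ C' r^{(m-3)/2} → 0`. [folklore] -/
theorem ae_eq_zero_of_weaklyHarmonic_of_growth {h : (EuclideanSpace ℝ (Fin 3)) → ℝ} (hloc : LocallyIntegrable h volume)
    (hharm : ∀ φ : (EuclideanSpace ℝ (Fin 3)) → ℝ, ContDiff ℝ (⊤ : ℕ∞) φ → HasCompactSupport φ → ∫ x, h x * (Δ φ) x = 0)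
    {K m r₀ : ℝ} (hm : m < 3)
    (hgrowth : ∀ r : ℝ, r₀ < r → 0 < r →
      ∫⁻ x in ball (0 : (EuclideanSpace ℝ (Fin 3))) r, ‖h x‖ₑ ^ 2 ≤ ENNReal.ofReal (K * r ^ m)) :
    h =ᵐ[volume] 0 := by
  obtain ⟨C, hC0, hC⟩ := exists_const_ae_abs_le_integral_of_weaklyHarmonic
  have hK0 : ∀ r : ℝ, r₀ < r → 0 < r → 0 ≤ K * r ^ m ∨ ∫⁻ x in ball (0 : (EuclideanSpace ℝ (Fin 3))) r, ‖h x‖ₑ ^ 2 = 0 := by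
    intro r hr hr0
    by_cases hK : 0 ≤ K * r ^ m
    · exact Or.inl hK
    · right
      have := hgrowth r hr hr0
      rw [ENNReal.ofReal_of_nonpos (not_le.mp hK).le] at this
      exact le_antisymm this bot_le
  -- volume of balls
  set V : ℝ≥0∞ := volume (ball (0 : (EuclideanSpace ℝ (Fin 3))) 1) with hV
  have hVtop : V ≠ ⊤ := measure_ball_lt_top.ne
  have hvol : ∀ r : ℝ, 0 < r → volume (ball (0 : (EuclideanSpace ℝ (Fin 3))) r) = ENNReal.ofReal (r ^ 3) * V := by
    intro r hr
    rw [Measure.addHaar_ball_of_pos volume 0 hr, finrank_euclideanSpace_fin, ← hV]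
  -- the a.e. bound on `B(0, r/2)` for `r > max r₀ 0`
  have hbound : ∀ r : ℝ, r₀ < r → 0 < r →
      ∀ᵐ x ∂(volume.restrict (ball (0 : (EuclideanSpace ℝ (Fin 3))) (r / 2))),
        |h x| ≤ C * (r ^ 3)⁻¹ * Real.sqrt (|K| * r ^ m * (r ^ 3 * V.toReal)) := by
    intro r hr hr0
    have hint : IntegrableOn h (ball (0 : (EuclideanSpace ℝ (Fin 3))) r) volume :=
      (hloc.integrableOn_isCompact (isCompact_closedBall 0 r)).mono_set ball_subset_closedBall
    have hh : ∀ φ : (EuclideanSpace ℝ (Fin 3)) → ℝ, ContDiff ℝ (⊤ : ℕ∞) φ → HasCompactSupport φ →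
        tsupport φ ⊆ ball (0 : (EuclideanSpace ℝ (Fin 3))) r → ∫ x, h x * (Δ φ) x = 0 :=
      fun φ hφ hφc _ => hharm φ hφ hφc
    have h1 := hC h 0 r hr0 hint hh
    -- Cauchy–Schwarz: `∫_{B_r} |h| ≤ (∫_{B_r} |h|²)^{1/2} |B_r|^{1/2}`
    have hmeas : AEMeasurable (fun x => ‖h x‖ₑ) (volume.restrict (ball (0 : (EuclideanSpace ℝ (Fin 3))) r)) :=
      hint.aestronglyMeasurable.aemeasurable.enorm
    have hcs : ∫⁻ x in ball (0 : (EuclideanSpace ℝ (Fin 3))) r, ‖h x‖ₑ ≤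
        (∫⁻ x in ball (0 : (EuclideanSpace ℝ (Fin 3))) r, ‖h x‖ₑ ^ 2) ^ (1 / 2 : ℝ) * (volume (ball (0 : (EuclideanSpace ℝ (Fin 3))) r)) ^ (1 / 2 : ℝ) := by
      have hpq : Real.HolderConjugate 2 2 := by
        constructor <;> norm_num
      have h2 := ENNReal.lintegral_mul_le_Lp_mul_Lq (volume.restrict (ball (0 : (EuclideanSpace ℝ (Fin 3))) r)) hpq hmeas
        (aemeasurable_const (b := (1 : ℝ≥0∞)))
      simp only [Pi.mul_apply, mul_one, ENNReal.one_rpow, lintegral_const, Measure.restrict_apply_univ,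
        one_div, one_mul] at h2
      have e1 : ∫⁻ x in ball (0 : (EuclideanSpace ℝ (Fin 3))) r, ‖h x‖ₑ ^ (2 : ℝ) = ∫⁻ x in ball (0 : (EuclideanSpace ℝ (Fin 3))) r, ‖h x‖ₑ ^ 2 := by
        refine lintegral_congr fun x => ?_
        rw [show (2 : ℝ) = ((2 : ℕ) : ℝ) by norm_num, ENNReal.rpow_natCast]
      rw [e1] at h2
      simpa only [one_div] using h2
    have hKr : ENNReal.ofReal (K * r ^ m) ≤ ENNReal.ofReal (|K| * r ^ m) :=
      ENNReal.ofReal_le_ofReal (mul_le_mul_of_nonneg_right (le_abs_self K) (Real.rpow_nonneg hr0.le m))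
    have hI : ∫ y in ball (0 : (EuclideanSpace ℝ (Fin 3))) r, |h y| ≤ Real.sqrt (|K| * r ^ m * (r ^ 3 * V.toReal)) := by
      have e2 : ∫ y in ball (0 : (EuclideanSpace ℝ (Fin 3))) r, |h y| = (∫⁻ x in ball (0 : (EuclideanSpace ℝ (Fin 3))) r, ‖h x‖ₑ).toReal := by
        rw [← integral_norm_eq_lintegral_enorm hint.aestronglyMeasurable]
        simp only [Real.norm_eq_abs]
      rw [e2]
      have h3 : ∫⁻ x in ball (0 : (EuclideanSpace ℝ (Fin 3))) r, ‖h x‖ₑ ≤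
          ENNReal.ofReal (Real.sqrt (|K| * r ^ m * (r ^ 3 * V.toReal))) := by
        refine hcs.trans ?_
        have h4 : (∫⁻ x in ball (0 : (EuclideanSpace ℝ (Fin 3))) r, ‖h x‖ₑ ^ 2) ^ (1 / 2 : ℝ) ≤
            (ENNReal.ofReal (|K| * r ^ m)) ^ (1 / 2 : ℝ) :=
          ENNReal.rpow_le_rpow ((hgrowth r hr hr0).trans hKr) (by norm_num)
        have h5 : (volume (ball (0 : (EuclideanSpace ℝ (Fin 3))) r)) ^ (1 / 2 : ℝ) =
            (ENNReal.ofReal (r ^ 3 * V.toReal)) ^ (1 / 2 : ℝ) := by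
          rw [hvol r hr0, ENNReal.ofReal_mul (by positivity), ENNReal.ofReal_toReal hVtop]
        calc (∫⁻ x in ball (0 : (EuclideanSpace ℝ (Fin 3))) r, ‖h x‖ₑ ^ 2) ^ (1 / 2 : ℝ) * (volume (ball (0 : (EuclideanSpace ℝ (Fin 3))) r)) ^ (1 / 2 : ℝ)
            ≤ (ENNReal.ofReal (|K| * r ^ m)) ^ (1 / 2 : ℝ) *
                (ENNReal.ofReal (r ^ 3 * V.toReal)) ^ (1 / 2 : ℝ) := by
              rw [← h5]; gcongr
          _ = ENNReal.ofReal (Real.sqrt (|K| * r ^ m * (r ^ 3 * V.toReal))) := by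
              rw [← ENNReal.mul_rpow_of_nonneg _ _ (by norm_num : (0 : ℝ) ≤ 1 / 2),
                ← ENNReal.ofReal_mul (by positivity), Real.sqrt_eq_rpow,
                ENNReal.ofReal_rpow_of_nonneg (by positivity) (by norm_num)]
      have := ENNReal.toReal_mono ENNReal.ofReal_ne_top h3
      rwa [ENNReal.toReal_ofReal (Real.sqrt_nonneg _)] at this
    filter_upwards [h1] with x hx
    exact hx.trans (mul_le_mul_of_nonneg_left hI (by positivity))
  -- the bound tends to zero as `r → ∞` (exponent `(m - 3)/2 < 0`)
  set B : ℝ → ℝ := fun r => C * (r ^ 3)⁻¹ * Real.sqrt (|K| * r ^ m * (r ^ 3 * V.toReal)) with hB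
  have hBlim : Tendsto B atTop (𝓝 0) := by
    have e : ∀ r : ℝ, 0 < r → B r = C * Real.sqrt (|K| * V.toReal) * r ^ ((m - 3) / 2) := by
      intro r hr
      simp only [hB]
      have h3 : (r ^ 3 : ℝ) = r ^ (3 : ℝ) := by norm_cast
      rw [h3, show |K| * r ^ m * (r ^ (3 : ℝ) * V.toReal) = (|K| * V.toReal) * (r ^ m * r ^ (3 : ℝ)) by ring,
        ← Real.rpow_add hr, Real.sqrt_mul (by positivity), Real.sqrt_eq_rpow (r ^ (m + 3)),
        ← Real.rpow_mul hr.le, ← Real.rpow_neg hr.le]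
      rw [show C * (r ^ (-(3 : ℝ))) * (Real.sqrt (|K| * V.toReal) * r ^ ((m + 3) * (1 / 2))) =
        C * Real.sqrt (|K| * V.toReal) * (r ^ (-(3 : ℝ)) * r ^ ((m + 3) * (1 / 2))) by ring,
        ← Real.rpow_add hr]
      congr 2
      ring
    have h1 : Tendsto (fun r : ℝ => C * Real.sqrt (|K| * V.toReal) * r ^ ((m - 3) / 2)) atTop (𝓝 0) := by
      have h2 : Tendsto (fun r : ℝ => r ^ ((m - 3) / 2)) atTop (𝓝 0) := by
        have := tendsto_rpow_neg_atTop (y := (3 - m) / 2) (by linarith)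
        refine this.congr fun r => ?_
        congr 1; ring
      simpa using h2.const_mul (C * Real.sqrt (|K| * V.toReal))
    refine (tendsto_congr' ?_).2 h1
    filter_upwards [eventually_gt_atTop 0] with r hr
    exact e r hr
  -- a.e. conclusion along the radii `r = n`, `n ∈ ℕ`
  have hall : ∀ᵐ x ∂(volume : Measure (EuclideanSpace ℝ (Fin 3))), ∀ n : ℕ, r₀ < (n : ℝ) → 0 < (n : ℝ) →
      x ∈ ball (0 : (EuclideanSpace ℝ (Fin 3))) ((n : ℝ) / 2) → |h x| ≤ B n := by
    refine ae_all_iff.2 fun n => ?_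
    by_cases hn : r₀ < (n : ℝ) ∧ 0 < (n : ℝ)
    · have := hbound n hn.1 hn.2
      rw [ae_restrict_iff' measurableSet_ball] at this
      filter_upwards [this] with x hx _ _ hxn
      exact hx hxn
    · exact Eventually.of_forall fun x h1 h2 _ => (hn ⟨h1, h2⟩).elim
  filter_upwards [hall] with x hx
  -- for `n` large, `x ∈ B(0, n/2)` and `|h x| ≤ B n → 0`
  have hev : ∀ᶠ n : ℕ in atTop, |h x| ≤ B n := by
    have h1 : Tendsto (fun n : ℕ => (n : ℝ)) atTop atTop := tendsto_natCast_atTop_atTop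
    filter_upwards [h1.eventually_gt_atTop r₀, h1.eventually_gt_atTop 0,
      h1.eventually_gt_atTop (2 * ‖x‖)] with n hn1 hn2 hn3
    refine hx n hn1 hn2 ?_
    rw [mem_ball_zero_iff]
    linarith
  have hlim : Tendsto (fun n : ℕ => B n) atTop (𝓝 0) := hBlim.comp tendsto_natCast_atTop_atTop
  have hle : |h x| ≤ 0 := ge_of_tendsto hlim hev
  simpa using abs_nonpos_iff.1 hle

/-! ## A field with symmetric, trace-free weak gradient and sub-volume growth vanishes -/

/-- A scalar test function times a constant vector is a vector test field. [folklore] -/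
theorem isTestFunctionOn_smul_const {g : (EuclideanSpace ℝ (Fin 3)) → ℝ} (hg : IsTestFunctionOn (⊤ : Opens (EuclideanSpace ℝ (Fin 3))) g) (c : (EuclideanSpace ℝ (Fin 3))) :
    IsTestFunctionOn (⊤ : Opens (EuclideanSpace ℝ (Fin 3))) (fun x => g x • c) := by
  refine ⟨hg.contDiff.smul contDiff_const, ?_, ?_⟩
  · exact (hg.hasCompactSupport.smul_right (f' := fun _ : (EuclideanSpace ℝ (Fin 3)) => c))
  · rw [Opens.coe_top]; exact subset_univ _

/-- `∂ₐ(g c) = (∂ₐ g) c`. [folklore] -/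
theorem fderiv_smul_const_apply' {g : (EuclideanSpace ℝ (Fin 3)) → ℝ} (hg : IsTestFunctionOn (⊤ : Opens (EuclideanSpace ℝ (Fin 3))) g) (c x a : (EuclideanSpace ℝ (Fin 3))) :
    fderiv ℝ (fun y => g y • c) x a = fderiv ℝ g x a • c := by
  have hd : DifferentiableAt ℝ g x := (hg.contDiff.differentiable (by simp)).differentiableAt
  rw [fderiv_smul_const hd]
  rfl

/-- **Weak irrotationality from a symmetric weak gradient.**  If `G` is a weak gradient of `f` on
`ℝ³` and `G(x)` is a.e. a symmetric linear map, then `f` annihilates the curl-type test fields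
`(∂ₐ g) c − (∂_c g) a`. [folklore] -/
theorem integral_inner_curlPair_eq_zero_of_symm {f : (EuclideanSpace ℝ (Fin 3)) → (EuclideanSpace ℝ (Fin 3))} {G : (EuclideanSpace ℝ (Fin 3)) → (EuclideanSpace ℝ (Fin 3)) →L[ℝ] (EuclideanSpace ℝ (Fin 3))}
    (hf : HasWeakGradient f G) (hsym : ∀ᵐ x ∂(volume : Measure (EuclideanSpace ℝ (Fin 3))), ∀ v w : (EuclideanSpace ℝ (Fin 3)), ⟪G x v, w⟫ = ⟪G x w, v⟫)
    {g : (EuclideanSpace ℝ (Fin 3)) → ℝ} (hg : IsTestFunctionOn (⊤ : Opens (EuclideanSpace ℝ (Fin 3))) g) (a c : (EuclideanSpace ℝ (Fin 3))) :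
    ∫ x, ⟪f x, fderiv ℝ g x a • c - fderiv ℝ g x c • a⟫ = 0 := by
  have hfl : LocallyIntegrable f volume := locallyIntegrableOn_univ.1 (by
    simpa only [Opens.coe_top] using hf.locallyIntegrableOn)
  have hWc := isTestFunctionOn_smul_const hg c
  have hWa := isTestFunctionOn_smul_const hg a
  -- the two pairings, via the vector weak-gradient identity
  have e1 : ∫ x, ⟪f x, fderiv ℝ g x a • c⟫ = -∫ x, g x * ⟪G x a, c⟫ := by
    have h1 := hf.integral_inner_fderiv_apply_test hWc a
    simp_rw [fderiv_smul_const_apply' hg] at h1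
    rw [h1]
    congr 1
    refine integral_congr_ae (Eventually.of_forall fun x => ?_)
    simp only [real_inner_smul_right]
  have e2 : ∫ x, ⟪f x, fderiv ℝ g x c • a⟫ = -∫ x, g x * ⟪G x c, a⟫ := by
    have h1 := hf.integral_inner_fderiv_apply_test hWa c
    simp_rw [fderiv_smul_const_apply' hg] at h1
    rw [h1]
    congr 1
    refine integral_congr_ae (Eventually.of_forall fun x => ?_)
    simp only [real_inner_smul_right]
  have e3 : ∫ x, g x * ⟪G x a, c⟫ = ∫ x, g x * ⟪G x c, a⟫ := by
    refine integral_congr_ae ?_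
    filter_upwards [hsym] with x hx
    rw [hx a c]
  -- integrability of the two pairings
  have i1 : Integrable (fun x => ⟪f x, fderiv ℝ g x a • c⟫) volume := by
    have := integrable_inner_of_locallyIntegrable_of_hasCompactSupport hfl
      ((hWc.contDiff.continuous_fderiv (by simp)).clm_apply continuous_const)
      (hWc.hasCompactSupport.fderiv_apply (𝕜 := ℝ) a)
    refine this.congr (Eventually.of_forall fun x => ?_)
    simp only [fderiv_smul_const_apply' hg]
  have i2 : Integrable (fun x => ⟪f x, fderiv ℝ g x c • a⟫) volume := by
    have := integrable_inner_of_locallyIntegrable_of_hasCompactSupport hfl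
      ((hWa.contDiff.continuous_fderiv (by simp)).clm_apply continuous_const)
      (hWa.hasCompactSupport.fderiv_apply (𝕜 := ℝ) c)
    refine this.congr (Eventually.of_forall fun x => ?_)
    simp only [fderiv_smul_const_apply' hg]
  simp_rw [inner_sub_right]
  rw [integral_sub i1 i2, e1, e2, e3, sub_self]

/-- **Weak divergence-freeness from a trace-free weak gradient.**  If `G` is a weak gradient of
`f` on `ℝ³` with `tr G(x) = Σⱼ (G(x) eⱼ)ⱼ = 0` a.e., then `f` is weakly divergence free. [folklore] -/
theorem isWeaklyDivFree_of_trace_eq_zero {f : (EuclideanSpace ℝ (Fin 3)) → (EuclideanSpace ℝ (Fin 3))} {G : (EuclideanSpace ℝ (Fin 3)) → (EuclideanSpace ℝ (Fin 3)) →L[ℝ] (EuclideanSpace ℝ (Fin 3))}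
    (hf : HasWeakGradient f G)
    (htr : ∀ᵐ x ∂(volume : Measure (EuclideanSpace ℝ (Fin 3))), ∑ j, G x (EuclideanSpace.single j (1 : ℝ)) j = 0) :
    IsWeaklyDivFree f := by
  intro θ hθ
  have hfl : LocallyIntegrable f volume := locallyIntegrableOn_univ.1 (by
    simpa only [Opens.coe_top] using hf.locallyIntegrableOn)
  have hGl : ∀ v : (EuclideanSpace ℝ (Fin 3)), LocallyIntegrable (fun x => G x v) volume := fun v =>
    locallyIntegrableOn_univ.1 (by
      simpa only [Opens.coe_top] using SobolevApprox.locallyIntegrableOn_deriv_apply hf v)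
  set b := EuclideanSpace.basisFun (Fin 3) ℝ with hb
  have hbi : ∀ i, b i = EuclideanSpace.single i (1 : ℝ) := fun i => by
    rw [hb, EuclideanSpace.basisFun_apply]
  have hW : ∀ i, IsTestFunctionOn (⊤ : Opens (EuclideanSpace ℝ (Fin 3))) (fun x => θ x • b i) := fun i =>
    isTestFunctionOn_smul_const hθ (b i)
  -- `⟪f, ∇θ⟫ = Σᵢ ⟪f, ∂ᵢ(θ bᵢ)⟫`
  have hpt : ∀ x, ⟪f x, gradient θ x⟫ = ∑ i, ⟪f x, fderiv ℝ (fun y => θ y • b i) x (b i)⟫ := by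
    intro x
    rw [gradient_eq_sum_fderiv_smul b θ x, inner_sum]
    refine Finset.sum_congr rfl fun i _ => ?_
    rw [fderiv_smul_const_apply' hθ]
  have iW : ∀ i, Integrable (fun x => ⟪f x, fderiv ℝ (fun y => θ y • b i) x (b i)⟫) volume := fun i =>
    integrable_inner_of_locallyIntegrable_of_hasCompactSupport hfl
      (((hW i).contDiff.continuous_fderiv (by simp)).clm_apply continuous_const)
      ((hW i).hasCompactSupport.fderiv_apply (𝕜 := ℝ) (b i))
  have eW : ∀ i, ∫ x, ⟪f x, fderiv ℝ (fun y => θ y • b i) x (b i)⟫ = -∫ x, θ x * ⟪G x (b i), b i⟫ := by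
    intro i
    rw [hf.integral_inner_fderiv_apply_test (hW i) (b i)]
    congr 1
    refine integral_congr_ae (Eventually.of_forall fun x => ?_)
    simp only [real_inner_smul_right]
  have iG : ∀ i, Integrable (fun x => θ x * ⟪G x (b i), b i⟫) volume := by
    intro i
    have := integrable_inner_of_locallyIntegrable_of_hasCompactSupport (hGl (b i))
      (hW i).contDiff.continuous (hW i).hasCompactSupport
    refine this.congr (Eventually.of_forall fun x => ?_)
    simp only [real_inner_smul_right]
  simp_rw [hpt]
  rw [integral_finsetSum _ fun i _ => iW i]
  simp_rw [eW]
  rw [Finset.sum_neg_distrib, neg_eq_zero, ← integral_finsetSum _ fun i _ => iG i]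
  have hae : (fun x => ∑ i, θ x * ⟪G x (b i), b i⟫) =ᵐ[volume] fun _ => 0 := by
    filter_upwards [htr] with x hx
    rw [← Finset.mul_sum]
    have : ∑ i, ⟪G x (b i), b i⟫ = ∑ j, G x (EuclideanSpace.single j (1 : ℝ)) j := by
      refine Finset.sum_congr rfl fun i _ => ?_
      rw [hbi, EuclideanSpace.inner_single_right]
      simp
    rw [this, hx, mul_zero]
  rw [integral_congr_ae hae, integral_zero]

/-- **A field on `ℝ³` with symmetric, trace-free weak gradient and sub-volume quadratic growth
vanishes.**  `curl f = 0` (symmetric weak gradient) and `div f = 0` (trace-free) make every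
component of `f` weakly harmonic (tree `integral_laplacian_mul_inner_eq_zero_of_curlPair`); the
growth bound `∫_{B(0,r)} |f|² ≤ K r^m`, `m < 3`, then forces `f = 0` a.e.
(`ae_eq_zero_of_weaklyHarmonic_of_growth`). [folklore] -/
theorem ae_eq_zero_of_symm_traceFree_of_growth {f : (EuclideanSpace ℝ (Fin 3)) → (EuclideanSpace ℝ (Fin 3))} {G : (EuclideanSpace ℝ (Fin 3)) → (EuclideanSpace ℝ (Fin 3)) →L[ℝ] (EuclideanSpace ℝ (Fin 3))}
    (hf : HasWeakGradient f G) (hsym : ∀ᵐ x ∂(volume : Measure (EuclideanSpace ℝ (Fin 3))), ∀ v w : (EuclideanSpace ℝ (Fin 3)), ⟪G x v, w⟫ = ⟪G x w, v⟫)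
    (htr : ∀ᵐ x ∂(volume : Measure (EuclideanSpace ℝ (Fin 3))), ∑ j, G x (EuclideanSpace.single j (1 : ℝ)) j = 0)
    {K m r₀ : ℝ} (hm : m < 3)
    (hgrowth : ∀ r : ℝ, r₀ < r → 0 < r →
      ∫⁻ x in ball (0 : (EuclideanSpace ℝ (Fin 3))) r, ‖f x‖ₑ ^ 2 ≤ ENNReal.ofReal (K * r ^ m)) :
    f =ᵐ[volume] 0 := by
  have hfl : LocallyIntegrable f volume := locallyIntegrableOn_univ.1 (by
    simpa only [Opens.coe_top] using hf.locallyIntegrableOn)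
  have hdiv := isWeaklyDivFree_of_trace_eq_zero hf htr
  have hcurl : ∀ g : (EuclideanSpace ℝ (Fin 3)) → ℝ, IsTestFunctionOn (⊤ : Opens (EuclideanSpace ℝ (Fin 3))) g → ∀ a c : (EuclideanSpace ℝ (Fin 3)),
      ∫ x, ⟪f x, fderiv ℝ g x a • c - fderiv ℝ g x c • a⟫ = 0 :=
    fun g hg a c => integral_inner_curlPair_eq_zero_of_symm hf hsym hg a c
  -- every coordinate is weakly harmonic with the same growth, hence zero
  have hcoord : ∀ i : Fin 3, (fun x => ⟪f x, EuclideanSpace.single i (1 : ℝ)⟫) =ᵐ[volume] 0 := by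
    intro i
    set a : (EuclideanSpace ℝ (Fin 3)) := EuclideanSpace.single i (1 : ℝ) with ha
    have ha1 : ‖a‖ = 1 := by
      rw [ha, PiLp.norm_single, norm_one]
    refine ae_eq_zero_of_weaklyHarmonic_of_growth (K := K) (m := m) (r₀ := r₀) ?_ ?_ hm ?_
    · have e1 : (fun x => ⟪f x, a⟫) = fun x => (innerSL ℝ a) (f x) := by
        funext x; simp only [innerSL_apply_apply, real_inner_comm]
      rw [e1, ← locallyIntegrableOn_univ]
      exact (innerSL ℝ a).locallyIntegrableOn_comp (locallyIntegrableOn_univ.2 hfl)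
    · intro φ hφ hφc
      have hθ : IsTestFunctionOn (⊤ : Opens (EuclideanSpace ℝ (Fin 3))) φ := ⟨hφ, hφc, by simp⟩
      have := integral_laplacian_mul_inner_eq_zero_of_curlPair hfl hdiv hcurl hθ a
      rw [← this]
      exact integral_congr_ae (Eventually.of_forall fun x => by simp only [mul_comm])
    · intro r hr hr0
      refine le_trans (lintegral_mono fun x => ?_) (hgrowth r hr hr0)
      gcongr
      rw [← ofReal_norm, ← ofReal_norm]
      exact ENNReal.ofReal_le_ofReal ((norm_inner_le_norm _ _).trans (by rw [ha1, mul_one]))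
  have hall := ae_all_iff.2 hcoord
  filter_upwards [hall] with x hx
  ext i
  have h1 := hx i
  simp only [Pi.zero_apply] at h1
  rw [EuclideanSpace.inner_single_right] at h1
  simpa using h1

end Summit.NavierStokesRegularity.NavierStokesRegularity.Theorems.PowerGaugeEulerLiouville

end
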